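/-
Copyright (c) 2026 the pub-hodgecm-mathlib formalisation cell (harness21).  Prover seat hodgecm-mathlib-K2E3-p14 (g10) (E3 hand on strike line L1; LEAD F0P6-plan (g15)
BATCH #263 (1), after C131-p02 (g0)'s first refusal), Track B «K2-LIT» ∕ hLiu418 = `stmt-HodgeConjecture-24832`: U1-glob LEVEL 2-fin ∕ block D ∕ K1-a♮ «ARCH-CONT» — the
PER-PLACE ARCHIMEDEAN WHITTAKER LETTER AT A RANK-ONE FRAMED INDEX, SCALAR PICTURE: the rank-one twin of ★ `K2LiuKindWArchWhittakerLetter` (LH4-p08), its tail swapped to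
★ C131-p02 p863260 `twistedArchBlock_scalarType_continuation{,_neg}`.  THEOREMS ONLY (no `def` ∕ `instance` ∕ notation ∕ named-fact hypothesis ∕ `sorry`).
-/
import Summits.HodgeConjecture.HodgeConjecture.Theorems.K2LiuArchBlockOfFrame                       -- ★ FILE 10 (LH4-p08): `antidiag_letters`, `antidiag_eq_J_mul_levi`, `levi_mul_transl`; chart ★ `integral_hermOfReal_eq`; ★ LeviEquivariance
import Summits.HodgeConjecture.HodgeConjecture.Theorems.K2LiuArchTwistedKTypeBlockContinuation       -- ★ (C131-p02): brings ★ p863260 `twistedArchBlock_scalarType_continuation` + ★ `…_neg`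
import Mathlib.Analysis.Matrix.Spectrum
import Mathlib.Analysis.CStarAlgebra.Matrix
import HarnessLib

/-!
# Crux `HLiu418`, arch-kernel ∕ «ARCH-CONT» — `K2LiuKindOneArchWhittakerLetterScalarType`: THE PER-PLACE TWISTED WHITTAKER LETTER `hW¹` AT A RANK-ONE FRAMED INDEX, SCALAR PICTURE
# `∃ Ew` holomorphic on `{0 < re s}` with `∫_{Her₂} e_w(b) · f⁰_{s,k}(x_w·n(b)·g_w) db = Ew(s)` on `{½ < re s}`   [Shimura1982 §4 Thm. 4.2; Shimura1997 §16.4, §18.4; KudlaRallis1994 §2]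

Cell `hodgecm-mathlib`, crux item hLiu418 = `stmt-HodgeConjecture-24832`; squad K2, strike line L1; LEAD F0P6-plan (g15) BATCH #263 (1); K1a desk K2Liu-p01 (g11) (its «ARCH-CONT»
`Ac hAc hA` slot), U1 END pen K2E3-p32 (g3), (D-arch-loc) LH4-p17 (g3).  Lane `--supports stmt-HodgeConjecture-24832 --as helper` (count-neutral).  THEOREMS ONLY.

THE LETTER.  ★ `K2LiuKindWArchWhittakerLetter.exists_twistedWhittaker_continuation_of_posDef` (LH4-p08) pays KIND-W's per-place letter `hW w` at a positive DEFINITE framed index: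
`∫_{Her₂} F(x·n(b)·g)·eb(b) db = Ew s` for every section `F` with a given compact picture, `Ew` holomorphic on `{0 < re}`.  The U1-glob arch-kernel branch (★ (α)-Σ p864470's `hAloc`,
★ p864643) and block D's (D-arch-loc) letters (★ p864236 `Araw Ac₀ hAc₀ hA₀`) need the SAME letter at a RANK-ONE hermitian framed index `h_w(σE₁₁)` (semidefinite of either sign),
for the section of SCALAR `K_w`-type `k` — the SCALAR PICTURE `F := f⁰_{s,k}` (★ `archScalarSection k s`).  THIS FILE pays it: LH4-p08's road up to the Levi step — ★ FILE 10 frame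
algebra `x·n(X)·g = J·n(CXCᴴ)·(m₀ g)` (`m₀ = diag(C, −B) ∈ U(J)`), the chart ★ `integral_hermOfReal_eq` (both directions) and the substitution ★ `integral_comp_hermTwo_conj`
(`X ↦ CXCᴴ`, index `h₁ = C⁻ᴴ·hidx·C⁻¹`, ★ `trace_mul_conj`) — then, INSTEAD of the arch Iwasawa + JUNCTION tail of the definite case, ONE spectral step (§1: a non-zero rank-one
semidefinite hermitian `2×2` matrix is `±a·hermTwo(t,0,0)·aᴴ` with `a` UNITARY, `t > 0` — Mathlib's spectral theorem, the flip `(0 1; 1 0)` when the zero eigenvalue comes first)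
and ★ C131-p02 p863260 `twistedArchBlock_scalarType_continuation` ∕ ★ `…_neg` at the `U(J)`-point `m₀ g` (which absorb the Iwasawa of the point themselves).  Value:
`Ew s = (‖det C‖⁴)⁻¹ · E_{p863260}(s)`.
* §1 `norm_det_eq_one_of_mul_conjTranspose`, **`exists_unitaryFrame_of_posSemidef_rankOne`** (the spectral step).
* §2 **`hW1_scalarType_rankOne`** — hypotheses: `k : ℤ`; `x = (0 B; C 0) ∈ U(J)`; `g ∈ U(J)`; `hidx` rank one (`det = 0`, `≠ 0`) and SEMIDEFINITE OF EITHER SIGN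
  (`hidx.PosSemidef ∨ (−hidx).PosSemidef`); the twist `eb b = e(−tr(hidx·b))` BY VALUE.  Conclusion: `∃ Ew, DifferentiableOn ℂ Ew {0 < re} ∧ ∀ s, ½ < re s →
  ∫ r, eb (hermOfReal r) · f⁰_{s,k}(x · n(hermOfReal r) · g) dr = Ew s` — ★ p864470's `hAloc` ∕ ★ p864643's clause at `Fs := archScalarSection k`, `Frx := x`, `Frg := g`, `blk ∘ nfr = hermOfReal`.
What is NOT here (honest): non-scalar compact pictures (the `K_w`-type sequel announced in ★ `K2LiuArchTwistedKTypeBlockContinuation`'s docstring); the hermitian-ness ∕ rank ∕ sign of the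
framed corner index `h_w(σE₁₁) = −2·(T_w)₂₂·σ_w(S)·(T_w⁻¹)₁₁` (the per-place signature bookkeeping of ★ `heb_of_hermitian_framedIndex`'s consumers, by value here).
References: [Shimura1982] §4 Thm. 4.2; [Shimura1997] §16.4, §18.4; [KudlaRallis1994] §2 (2.10)–(2.12); [HornJohnson2013] Thm. 4.1.5 (spectral theorem), §7.1.
HONEST LABEL.  Count-neutral helper: `HC_CM` is proved only modulo the 7 printed citations (2 remaining named inputs: hLiu418 = `stmt-HodgeConjecture-24832`,
h413 = `stmt-HodgeConjecture-24833`) until rung 0 closes; closes no socket.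
-/

set_option autoImplicit false
set_option linter.dupNamespace false -- the mandated namespace repeats `HodgeConjecture.HodgeConjecture`

noncomputable section

open Complex Matrix MeasureTheory
open scoped ComplexConjugate ComplexOrder

namespace Summit.HodgeConjecture.HodgeConjecture.Cruxes.HLiu418.K2LiuKindOneArchWhittakerLetterScalarType

open Summit.HodgeConjecture.HodgeConjecture.Cruxes.HLiu418.K2LiuHermTwoGammaDefs (hermTwo)
open Summit.HodgeConjecture.HodgeConjecture.Cruxes.HLiu418.K2LiuHermitianTubeCocycle (mul_mem_UJ)
open Summit.HodgeConjecture.HodgeConjecture.Cruxes.HLiu418.K2LiuArchInducedTubeDefs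
open Summit.HodgeConjecture.HodgeConjecture.Cruxes.HLiu418.K2LiuArchWhittakerLeviEquivariance
open Summit.HodgeConjecture.HodgeConjecture.Cruxes.HLiu418.K2LiuArchIntertwiningScalarValue (integral_hermOfReal_eq)
open Summit.HodgeConjecture.HodgeConjecture.Cruxes.HLiu418.K2LiuArchBlockOfFrame (antidiag_letters antidiag_eq_J_mul_levi levi_mul_transl)
open Summit.HodgeConjecture.HodgeConjecture.Cruxes.HLiu418.K2LiuArchTwistedScalarBlockContinuation (twistedArchBlock_scalarType_continuation)
open Summit.HodgeConjecture.HodgeConjecture.Cruxes.HLiu418.K2LiuArchTwistedScalarBlockContinuationNeg (twistedArchBlock_scalarType_continuation_neg)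

/-! ## §1 The spectral step: a non-zero rank-one semidefinite hermitian `2×2` matrix is `a·hermTwo(t,0,0)·aᴴ` with `a` unitary -/

/-- `‖det U‖ = 1` for `U·Uᴴ = 1`. [folklore] -/
theorem norm_det_eq_one_of_mul_conjTranspose {U : Matrix (Fin 2) (Fin 2) ℂ} (hU : U * Uᴴ = 1) : ‖U.det‖ = 1 := by
  have h1 : U.det * star U.det = 1 := by
    rw [← Matrix.det_conjTranspose, ← Matrix.det_mul, hU, Matrix.det_one]
  have h2 : ‖U.det‖ * ‖U.det‖ = 1 := by
    have := congrArg norm h1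
    rwa [norm_mul, Complex.star_def, Complex.norm_conj, norm_one] at this
  nlinarith [norm_nonneg U.det]

/-- the flip `P = (0 1; 1 0)`: `P·Pᴴ = 1` and `‖det P‖ = 1`. [folklore] -/
theorem flip_mul_conjTranspose : (!![(0 : ℂ), 1; 1, 0] : Matrix (Fin 2) (Fin 2) ℂ) * (!![(0 : ℂ), 1; 1, 0] : Matrix (Fin 2) (Fin 2) ℂ)ᴴ = 1 := by
  ext i j; fin_cases i <;> fin_cases j <;> simp [Matrix.mul_apply, Fin.sum_univ_two, Matrix.conjTranspose_apply]

/-- the flip conjugates `hermTwo (t, 0, 0) = diag(t, 0)` to `diag(0, t)`. [folklore] -/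
theorem flip_mul_hermTwo_mul_flip (t : ℝ) :
    (!![(0 : ℂ), 1; 1, 0] : Matrix (Fin 2) (Fin 2) ℂ) * hermTwo (t, 0, 0) * (!![(0 : ℂ), 1; 1, 0] : Matrix (Fin 2) (Fin 2) ℂ)ᴴ =
      diagonal (fun i => ((![0, t] i : ℝ) : ℂ)) := by
  ext i j; fin_cases i <;> fin_cases j <;>
    simp [hermTwo, Matrix.mul_apply, Fin.sum_univ_two, Matrix.conjTranspose_apply, Matrix.diagonal]

/-- `hermTwo (t, 0, 0) = diag(t, 0)`. [folklore] -/
theorem hermTwo_eq_diagonal (t : ℝ) : hermTwo (t, 0, 0) = diagonal (fun i => ((![t, 0] i : ℝ) : ℂ)) := by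
  ext i j; fin_cases i <;> fin_cases j <;> simp [hermTwo, Matrix.diagonal]

/-- **THE SPECTRAL STEP.**  A positive SEMIDEFINITE hermitian `2×2` matrix of RANK ONE (`det h = 0`, `h ≠ 0`) is `a·hermTwo(t,0,0)·aᴴ` with `‖det a‖ = 1` and `t > 0`
(`a` = the unitary eigenvector frame, flipped when the zero eigenvalue comes first; `t` = the positive eigenvalue). [cite: HornJohnson2013, Thm. 4.1.5] -/
theorem exists_unitaryFrame_of_posSemidef_rankOne {h : Matrix (Fin 2) (Fin 2) ℂ} (hsd : h.PosSemidef) (hdet : h.det = 0) (hne : h ≠ 0) :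
    ∃ (a : Matrix (Fin 2) (Fin 2) ℂ) (t : ℝ), ‖a.det‖ = 1 ∧ 0 < t ∧ h = a * hermTwo (t, 0, 0) * aᴴ := by
  -- the spectral data
  obtain ⟨U, hUdef⟩ : ∃ U : Matrix (Fin 2) (Fin 2) ℂ, (hsd.1.eigenvectorUnitary : Matrix (Fin 2) (Fin 2) ℂ) = U := ⟨_, rfl⟩
  obtain ⟨d, hddef⟩ : ∃ d : Fin 2 → ℝ, hsd.1.eigenvalues = d := ⟨_, rfl⟩
  have hcomp : (RCLike.ofReal ∘ d : Fin 2 → ℂ) = fun i => ((d i : ℝ) : ℂ) := rfl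
  have hUU : U * Uᴴ = 1 := by
    have := Unitary.coe_mul_star_self hsd.1.eigenvectorUnitary
    rw [Unitary.coe_star, Matrix.star_eq_conjTranspose, hUdef] at this
    exact this
  have hsp : h = U * diagonal (fun i => ((d i : ℝ) : ℂ)) * Uᴴ := by
    have := hsd.1.spectral_theorem
    rw [Unitary.conjStarAlgAut_apply, Matrix.star_eq_conjTranspose, hUdef, hddef, hcomp] at this
    exact this
  have hUdet : ‖U.det‖ = 1 := norm_det_eq_one_of_mul_conjTranspose hUU
  -- the eigenvalues: non-negative, product zero, not both zero
  have hd0 : 0 ≤ d 0 := by have := hsd.eigenvalues_nonneg 0; rwa [hddef] at this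
  have hd1 : 0 ≤ d 1 := by have := hsd.eigenvalues_nonneg 1; rwa [hddef] at this
  have hprod : d 0 * d 1 = 0 := by
    have h1 := hsd.1.det_eq_prod_eigenvalues
    rw [hdet, hddef, Fin.prod_univ_two] at h1
    have h2 : (((d 0 * d 1 : ℝ)) : ℂ) = 0 := by rw [Complex.ofReal_mul]; exact h1.symm
    exact_mod_cast h2
  have hnz : ¬ (d 0 = 0 ∧ d 1 = 0) := by
    rintro ⟨h0, h1⟩
    apply hne
    rw [hsp]
    have : diagonal (fun i => ((d i : ℝ) : ℂ)) = 0 := by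
      ext i j; fin_cases i <;> fin_cases j <;> simp [Matrix.diagonal, h0, h1]
    rw [this, Matrix.mul_zero, Matrix.zero_mul]
  rcases mul_eq_zero.1 hprod with h0 | h1
  · -- zero eigenvalue first: flip
    have hd1' : d 1 ≠ 0 := fun h1 => hnz ⟨h0, h1⟩
    have hpos : 0 < d 1 := lt_of_le_of_ne hd1 (Ne.symm hd1')
    refine ⟨U * !![(0 : ℂ), 1; 1, 0], d 1, ?_, hpos, ?_⟩
    · rw [Matrix.det_mul, norm_mul, hUdet, one_mul, Matrix.det_fin_two_of]; simp
    · have hdiag : diagonal (fun i => ((d i : ℝ) : ℂ)) = diagonal (fun i => ((![0, d 1] i : ℝ) : ℂ)) := by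
        ext i j; fin_cases i <;> fin_cases j <;> simp [Matrix.diagonal, h0]
      rw [hsp, hdiag, ← flip_mul_hermTwo_mul_flip (d 1), Matrix.conjTranspose_mul]
      simp only [Matrix.mul_assoc]
  · -- zero eigenvalue second
    have hd0' : d 0 ≠ 0 := fun h0 => hnz ⟨h0, h1⟩
    have hpos : 0 < d 0 := lt_of_le_of_ne hd0 (Ne.symm hd0')
    refine ⟨U, d 0, hUdet, hpos, ?_⟩
    have hdiag : diagonal (fun i => ((d i : ℝ) : ℂ)) = hermTwo (d 0, 0, 0) := by
      rw [hermTwo_eq_diagonal]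
      ext i j; fin_cases i <;> fin_cases j <;> simp [Matrix.diagonal, h1]
    rw [hsp, hdiag]

/-! ## §2 The per-place twisted Whittaker letter at a rank-one framed index, scalar picture -/

/-- **`hW¹` — THE PER-PLACE ARCHIMEDEAN TWISTED WHITTAKER LETTER AT A RANK-ONE FRAMED INDEX, SCALAR PICTURE.**  Data at one complex place: a scalar `K_w`-type `k : ℤ`, the frame image
`x = (0 B; C 0) ∈ U(J)` of `w_Δ`, a point `g ∈ U(J)`, a RANK-ONE hermitian framed index `hidx` (`det hidx = 0`, `hidx ≠ 0`) SEMIDEFINITE OF EITHER SIGN, and the twist `eb` with its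
reading `eb b = e(−tr(hidx·b))` BY VALUE.  CONCLUSION: `∃ Ew` holomorphic on `{0 < re s}` with `∫ r, eb (hermOfReal r) · f⁰_{s,k}(x·n(hermOfReal r)·g) dr = Ew s` for `½ < re s` — ★ (α)-Σ
p864470's `hAloc` ∕ ★ p864643's local clause at the scalar picture (`Fs := archScalarSection k`, `Frx := x`, `Frg := g`, `blk ∘ nfr = hermOfReal`).  Road: ★ FILE 10 frame algebra, chart ★
`integral_hermOfReal_eq`, substitution ★ `integral_comp_hermTwo_conj` (index `h₁ = C⁻ᴴ·hidx·C⁻¹`), chart back, §1 spectral step on `±h₁`, ★ p863260 ∕ ★ `…_neg` at `m₀·g ∈ U(J)`.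
[cite: Shimura1982, §4 Thm. 4.2] [cite: Shimura1997, §16.4, §18.4] [cite: KudlaRallis1994, §2 (2.10)–(2.12)] -/
theorem hW1_scalarType_rankOne (k : ℤ) {B C : Matrix (Fin 2) (Fin 2) ℂ}
    (hx : (fromBlocks 0 B C 0 : Matrix (Fin 2 ⊕ Fin 2) (Fin 2 ⊕ Fin 2) ℂ)ᴴ * Matrix.J (Fin 2) ℂ * (fromBlocks 0 B C 0 : Matrix (Fin 2 ⊕ Fin 2) (Fin 2 ⊕ Fin 2) ℂ) =
      Matrix.J (Fin 2) ℂ)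
    {g : Matrix (Fin 2 ⊕ Fin 2) (Fin 2 ⊕ Fin 2) ℂ} (hg : gᴴ * Matrix.J (Fin 2) ℂ * g = Matrix.J (Fin 2) ℂ)
    {hidx : Matrix (Fin 2) (Fin 2) ℂ} (hsd : hidx.PosSemidef ∨ (-hidx).PosSemidef) (hdet0 : hidx.det = 0) (hne : hidx ≠ 0)
    {eb : Matrix (Fin 2) (Fin 2) ℂ → ℂ} (heb : ∀ b, eb b = cexp (-(2 * Real.pi * I) * (hidx * b).trace)) :
    ∃ Ew : ℂ → ℂ, DifferentiableOn ℂ Ew {s : ℂ | 0 < s.re} ∧ ∀ s : ℂ, 1 / 2 < s.re →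
      ∫ r : Fin 2 → Fin 2 → ℝ, eb (hermOfReal r) *
          archScalarSection k s ((fromBlocks 0 B C 0 : Matrix (Fin 2 ⊕ Fin 2) (Fin 2 ⊕ Fin 2) ℂ) * fromBlocks 1 (hermOfReal r) 0 1 * g) = Ew s := by
  /- §0 frame letters -/
  obtain ⟨hCB, hBC⟩ := antidiag_letters hx
  have hC : C.det ≠ 0 := (Matrix.isUnit_det_of_left_inverse hBC).ne_zero
  have hCu : IsUnit C.det := isUnit_iff_ne_zero.2 hC
  have hCiC : C⁻¹ * C = 1 := Matrix.nonsing_inv_mul C hCu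
  have hCCi : C * C⁻¹ = 1 := Matrix.mul_nonsing_inv C hCu
  have hm₀ := levi_mem hBC                                   -- `m₀ := diag(C, −B) ∈ U(J)`
  have hg' := mul_mem_UJ hm₀ hg                              -- `g' := m₀ · g ∈ U(J)`
  /- §1 the conjugated index `h₁ = C⁻ᴴ·hidx·C⁻¹`: rank one, non-zero, semidefinite of the same sign -/
  set h₁ : Matrix (Fin 2) (Fin 2) ℂ := (C⁻¹)ᴴ * hidx * C⁻¹ with hh₁
  have hback : Cᴴ * h₁ * C = hidx := by
    rw [hh₁, show Cᴴ * ((C⁻¹)ᴴ * hidx * C⁻¹) * C = (C⁻¹ * C)ᴴ * hidx * (C⁻¹ * C) by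
      rw [Matrix.conjTranspose_mul]; simp only [Matrix.mul_assoc], hCiC, Matrix.conjTranspose_one, Matrix.one_mul, Matrix.mul_one]
  have h₁det : h₁.det = 0 := by rw [hh₁, Matrix.det_mul, Matrix.det_mul, hdet0, mul_zero, zero_mul]
  have h₁ne : h₁ ≠ 0 := fun h0 => hne (by rw [← hback, h0, Matrix.mul_zero, Matrix.zero_mul])
  have h₁sd : h₁.PosSemidef ∨ (-h₁).PosSemidef := by
    rcases hsd with hp | hn
    · exact Or.inl (by rw [hh₁]; exact hp.conjTranspose_mul_mul_same C⁻¹)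
    · refine Or.inr ?_
      have : -h₁ = (C⁻¹)ᴴ * (-hidx) * C⁻¹ := by rw [hh₁, Matrix.mul_neg, Matrix.neg_mul]
      rw [this]; exact hn.conjTranspose_mul_mul_same C⁻¹
  /- §2 frame algebra + chart + substitution: the integral at `x, g, hidx` is `(‖det C‖⁴)⁻¹ ×` the integral at `J, g′, h₁` -/
  -- the twist read at `h₁`: `eb X = e₁ (C X Cᴴ)`
  have heb₁ : ∀ X : Matrix (Fin 2) (Fin 2) ℂ, eb X = cexp (-(2 * Real.pi * I) * (h₁ * (C * X * Cᴴ)).trace) := by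
    intro X
    rw [heb, trace_mul_conj h₁ C X, hh₁]
    congr 3
    rw [show Cᴴ * ((C⁻¹)ᴴ * hidx * C⁻¹) * C = (C⁻¹ * C)ᴴ * hidx * (C⁻¹ * C) by
      rw [Matrix.conjTranspose_mul]; simp only [Matrix.mul_assoc], hCiC, Matrix.conjTranspose_one, Matrix.one_mul, Matrix.mul_one]
  -- the frame algebra: `x · n(X) · g = J · n(C X Cᴴ) · g'`
  have e1 : ∀ X : Matrix (Fin 2) (Fin 2) ℂ, (fromBlocks 0 B C 0 : Matrix (Fin 2 ⊕ Fin 2) (Fin 2 ⊕ Fin 2) ℂ) * fromBlocks 1 X 0 1 * g =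
      Matrix.J (Fin 2) ℂ * fromBlocks 1 (C * X * Cᴴ) 0 1 * (fromBlocks C 0 0 (-B) * g) := by
    intro X
    rw [antidiag_eq_J_mul_levi, Matrix.mul_assoc (Matrix.J (Fin 2) ℂ), levi_mul_transl hCB, ← Matrix.mul_assoc (Matrix.J (Fin 2) ℂ),
      Matrix.mul_assoc _ _ g]
  /- §3 the spectral step on `±h₁` and ★ C131-p02's continuation at the `U(J)`-point `g′ = m₀·g` -/
  have key : ∃ E : ℂ → ℂ, DifferentiableOn ℂ E {s : ℂ | 0 < s.re} ∧ ∀ s : ℂ, 1 / 2 < s.re →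
      (∫ r : Fin 2 → Fin 2 → ℝ, cexp (-(2 * Real.pi * I) * (h₁ * hermOfReal r).trace) *
        archScalarSection k s (Matrix.J (Fin 2) ℂ * fromBlocks 1 (hermOfReal r) 0 1 * (fromBlocks C 0 0 (-B) * g))) = E s := by
    rcases h₁sd with hp | hn
    · obtain ⟨a, t, hadet, ht, hT⟩ := exists_unitaryFrame_of_posSemidef_rankOne hp h₁det h₁ne
      obtain ⟨N, hN⟩ := exists_nat_gt (((k : ℤ) : ℝ) / 2)
      obtain ⟨E, hEd, hEeq⟩ := twistedArchBlock_scalarType_continuation k hg' hadet ht hN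
      refine ⟨E, hEd, fun s hs => ?_⟩
      rw [hT]
      exact hEeq s hs
    · have hnd : (-h₁).det = 0 := by rw [Matrix.det_neg, h₁det, mul_zero]
      have hnn : -h₁ ≠ 0 := fun h0 => h₁ne (neg_eq_zero.1 h0)
      obtain ⟨a, t, hadet, ht, hT⟩ := exists_unitaryFrame_of_posSemidef_rankOne hn hnd hnn
      obtain ⟨N, hN⟩ := exists_nat_gt (-((k : ℤ) : ℝ) / 2)
      obtain ⟨E, hEd, hEeq⟩ := twistedArchBlock_scalarType_continuation_neg k hg' hadet ht hN
      refine ⟨E, hEd, fun s hs => ?_⟩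
      rw [show h₁ = -(a * hermTwo (t, 0, 0) * aᴴ) by rw [← hT, neg_neg]]
      exact hEeq s hs
  obtain ⟨E, hEd, hEeq⟩ := key
  have hC4 : (((‖C.det‖ ^ 4 : ℝ)) : ℂ) ≠ 0 := by exact_mod_cast pow_ne_zero 4 (norm_ne_zero_iff.2 hC)
  refine ⟨fun s => ((((‖C.det‖ ^ 4 : ℝ)) : ℂ))⁻¹ * E s, (differentiableOn_const _).mul hEd, fun s hs => ?_⟩
  /- §4 frame algebra + chart + substitution + chart back, at `½ < re s` -/
  -- the integrand in the conjugated chart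
  set G : Matrix (Fin 2) (Fin 2) ℂ → ℂ := fun Y =>
    cexp (-(2 * Real.pi * I) * (h₁ * Y).trace) * archScalarSection k s (Matrix.J (Fin 2) ℂ * fromBlocks 1 Y 0 1 * (fromBlocks C 0 0 (-B) * g)) with hG
  have hAB : ∀ X : Matrix (Fin 2) (Fin 2) ℂ,
      eb X * archScalarSection k s ((fromBlocks 0 B C 0 : Matrix (Fin 2 ⊕ Fin 2) (Fin 2 ⊕ Fin 2) ℂ) * fromBlocks 1 X 0 1 * g) = G (C * X * Cᴴ) := by
    intro X; rw [hG, e1, heb₁]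
  calc ∫ r : Fin 2 → Fin 2 → ℝ, eb (hermOfReal r) *
          archScalarSection k s ((fromBlocks 0 B C 0 : Matrix (Fin 2 ⊕ Fin 2) (Fin 2 ⊕ Fin 2) ℂ) * fromBlocks 1 (hermOfReal r) 0 1 * g)
      = (1 / 8 : ℂ) * ∫ c : ℝ × ℂ × ℝ, G (C * hermTwo c * Cᴴ) := by
        rw [integral_hermOfReal_eq (fun X => eb X *
          archScalarSection k s ((fromBlocks 0 B C 0 : Matrix (Fin 2 ⊕ Fin 2) (Fin 2 ⊕ Fin 2) ℂ) * fromBlocks 1 X 0 1 * g))]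
        simp only [hAB]
    _ = (1 / 8 : ℂ) * (((((‖C.det‖ ^ 4 : ℝ)) : ℂ))⁻¹ * ∫ c : ℝ × ℂ × ℝ, G (hermTwo c)) := by
        congr 1
        rw [integral_comp_hermTwo_conj hC G, Complex.real_smul, ← mul_assoc, inv_mul_cancel₀ hC4, one_mul]
    _ = ((((‖C.det‖ ^ 4 : ℝ)) : ℂ))⁻¹ * ∫ r : Fin 2 → Fin 2 → ℝ, G (hermOfReal r) := by
        rw [integral_hermOfReal_eq G]; ring
    _ = ((((‖C.det‖ ^ 4 : ℝ)) : ℂ))⁻¹ * E s := by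
        rw [← hEeq s hs]

end Summit.HodgeConjecture.HodgeConjecture.Cruxes.HLiu418.K2LiuKindOneArchWhittakerLetterScalarType

end
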